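import Literature.Probability.RandomPlanarGeometry.SAWCountZdSymbolSecondLowerCount
import Literature.Probability.RandomPlanarGeometry.SAWCountZdSymbolSplitRun
import HarnessLib

/-!
# LETTER CONDITIONS IN A ONE-BLOCK SHAPE CLASS (every `m`): prescribed letters count as «position in a block» × `2^{m−3}`; marked blocks of `twoParts`; the five-run decomposition

Topic `Literature/Probability/RandomPlanarGeometry` (the «SYMBOL POLYNOMIALITY» programme, third layer; on `SAWCountZdSymbolBlockData.lean` (a-p1 g26: the one-block bijection
`κ ↦ (partOf p κ, signsOf p κ)` ↔ `canon ∘ mkWordP` between `shapeClass j m (topVec m p)` and `blockData = goodParts ×ˢ powerset (freePos)`, `blockOf_partOf`, `top_block_general`),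
`SAWCountZdSymbolSecondLowerCount.lean` (a-p1 g26: `twoParts`, the (A, B, ρ) data `abData`, `abOf`/`ofAB`, ★★ `card_goodParts_eq_card_abData`, `exists_unique_triple_of_mem_twoParts`),
`SAWCountZdSymbolFiveRun.lean` / `SAWCountZdSymbolSplitRun.lean` (a-p1 g26: `fiveVec`, `mem_topVec_of_mem_fiveVec` (every `m`), `mem_shapeClass_iff`), λ1–λ3 (`topVec`, `axCls`,
`freePos`, `signsOf`), the perfect matchings `pairPartitions` of `HiggsFluctMeasureWickPairings.lean` (Glimm–Jaffe (3.2.13))).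

PRINTED CONTEXT (locators only; nothing is quoted digit-for-digit). Madras–Slade (1993) §1.1 eq. (1.1.8) p. 5, Definition 1.2.4, §1.2 p. 10; Clisby–Liang–Slade (2007)
§3.3 eqs. (29)/(31); Glimm–Jaffe (1987) (3.2.13); Stanley EC1 §1.3 (set partitions with prescribed blocks). NOT IN PRINT as far as the lane's desks could locate: the statements
below (lane lemmas about the lane's shape classes; the general-`m` toolkit for the third-layer corners `X'_j` (`m = 2j − 1`) and `T'_j` (`m = 2j`)).

THE RESULTS (all for EVERY `m`, `p + 4 ≤ m`). (1) ★★ `card_filter_letter_eq` / `card_filter_letter_rev`: in the one-block class `T_p = shapeClass j m (topVec m p)`, for free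
positions `q ≠ q'` the members with `κ q' = κ q` (resp. `κ q' = rev (κ q)`) number **`#{π ∈ goodParts | q' ∈ blockOf π q} · 2^{m−3}`** — through the bijection a letter
equality is «same block, tied sign» (`fst_eq_iff_mem_blockOf_partOf`, `snd_iff_mem_signsOf`; tied sign sets: `card_powerset_filter_mem_iff` = `2^{#F−1}`; transport of filtered
cardinalities along a bijection given by a left inverse and equal cardinalities: `card_filter_eq_of_leftInv`). (2) The good-partition side in (A, B, ρ) coordinates:
★ `card_goodParts_filter_blockOf_base` (`q' ∈ blockOf π p ⟺ q' ∈ A`), `…_succ` (`p+1`, `B`), ★ `card_goodParts_filter_blockOf_outer` (outer `q, q'` share a block ⟺ both in `A`, both in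
`B`, or a common block of `ρ`). (3) Marked blocks of `twoParts`: ★ `card_twoParts_filter_pair_mem` (`{a,b}` a block ⟷ `twoParts (W ∖ {a,b}) (k−1)`), ★ `card_twoParts_filter_triple_mem`
(on `2k+1` points, `a, b` in the triple: `(2k−1)·(2k−3)‼`), `sameBlock_iff_of_card_eq_succ` / `sameBlock_iff_of_card_eq` (on `2k+1` points «same block» = the pair block or the
triple; on `2k` points = the pair block). (4) THE FIVE-RUN DECOMPOSITION for every `m`: ★★ `shapeClass_fiveVec_eq_union_filter` — `shapeClass j m (fiveVec m s)` is the union of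
the one-block classes at offsets `0` and `1` cut by the one extra no-reversal condition each; ★ `inter_topVec_succ_eq_filter` — their intersection is `{κ ∈ T_s | κ (s+4) = κ s}`
(the overlap `x y x̄ ȳ x`); ★★ `card_shapeClass_fiveVec_add`: **`#five(s) + #{κ ∈ T_s | κ(s+4) = κ(s+1)} + #{κ ∈ T_{s+1} | κ s = rev κ(s+1)} + #{κ ∈ T_s | κ(s+4) = κ s} =
#T_s + #T_{s+1}`** (for `m = 2j` the three corrections vanish — a third occurrence of an axis — recovering `SAWCountZdSymbolFiveRun`; for `m = 2j − 1` each is `(2j−7)‼·2^{2j−4}`,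
the sequel `SAWCountZdSymbolThirdMidCount.lean`).

THIS FILE (lane «pcv-sawmu», a-p1 g27; all PROVED, standard axioms): `card_filter_eq_of_leftInv` (private), `fst_eq_iff_mem_blockOf_partOf`, `snd_iff_mem_signsOf`,
`card_powerset_filter_mem_iff` (private), ★ `card_filter_letter_core`, ★★ `card_filter_letter_eq`, ★★ `card_filter_letter_rev`, `ofAB_abOf` (private), `card_goodParts_filter_eq`,
★ `card_goodParts_filter_blockOf_base`, ★ `card_goodParts_filter_blockOf_succ`, ★ `card_goodParts_filter_blockOf_outer`, ★ `card_twoParts_filter_pair_mem`,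
★ `card_twoParts_filter_triple_mem`,
`sameBlock_iff_of_card_eq_succ`, `sameBlock_iff_of_card_eq`, ★★ `shapeClass_fiveVec_eq_union_filter`, ★ `inter_topVec_succ_eq_filter`, ★★ `card_shapeClass_fiveVec_add`.
[cite: MadrasSlade1993, §1.1 eq. (1.1.8) p. 5; Definition 1.2.4; §1.2 (p. 10)] [cite: ClisbyLiangSlade2007, §3.3 eqs. (29)/(31)] [cite: GlimmJaffeQP1987, (3.2.13) §3.2]
[cite: Stanley2012EC1, §1.3]

Provenance: lane «pcv-sawmu», a-p1 g27 (2026-08-28).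
-/

open Finset
open scoped BigOperators
open Literature.Probability.LatticeModels
open Literature.Probability.RandomPlanarGeometry.SAW
open Literature.Probability.Percolation
open Literature.MathematicalPhysics.QuantumFieldTheory.Balaban1983to89
open Literature.MathematicalPhysics.QuantumFieldTheory.Balaban1983to89.HiggsFluctMeasureWickPairings

namespace Literature.Probability.RandomPlanarGeometry.SAW.Zd

namespace WordTypes

variable {m : ℕ}

/-! ### Transport of filtered cardinalities along a bijection -/

/-- A map into `t` with a left inverse on `s` and `#s = #t` is a bijection; filtered cardinalities agree for predicates that correspond.
[cite: Stanley2012EC1, §1.3; lane plumbing] -/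
private theorem card_filter_eq_of_leftInv {α β : Type*} [DecidableEq α] [DecidableEq β] {s : Finset α} {t : Finset β} (i : α → β) (g : β → α)
    (hi : ∀ a ∈ s, i a ∈ t) (hleft : ∀ a ∈ s, g (i a) = a) (hcard : s.card = t.card) (P : α → Prop) (Q : β → Prop) [DecidablePred P] [DecidablePred Q]
    (hPQ : ∀ a ∈ s, P a ↔ Q (i a)) : (s.filter P).card = (t.filter Q).card := by
  have hinj : Set.InjOn i s := fun a ha b hb h => by
    have := congrArg g h
    rwa [hleft a (Finset.mem_coe.1 ha), hleft b (Finset.mem_coe.1 hb)] at this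
  have himg : s.image i = t :=
    Finset.eq_of_subset_of_card_le (Finset.image_subset_iff.2 hi) (by rw [Finset.card_image_of_injOn hinj, hcard])
  rw [← himg, Finset.filter_image, Finset.card_image_of_injOn (fun a ha b hb h =>
    hinj (Finset.mem_filter.1 (Finset.mem_coe.1 ha)).1 (Finset.mem_filter.1 (Finset.mem_coe.1 hb)).1 h), Finset.filter_congr (s := s) (fun a ha => hPQ a ha)]

/-! ### The dictionary: letters of a class member ↔ its block datum -/

variable {p : ℕ}

/-- Two free positions carry the same axis iff one lies in the other's block of `partOf`. [cite: MadrasSlade1993, Definition 1.2.4; lane plumbing] -/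
theorem fst_eq_iff_mem_blockOf_partOf (κ : Word m m) {q q' : Fin m} (hq : q ∈ freePos m p) (hq' : q' ∈ freePos m p) :
    (κ q').1 = (κ q).1 ↔ q' ∈ blockOf (partOf p κ) q := by
  rw [blockOf_partOf κ hq, Finset.mem_inter, mem_axCls]
  exact ⟨fun h => ⟨h, hq'⟩, fun h => h.1⟩

/-- A free position has sign `+` iff it lies in `signsOf`. [cite: MadrasSlade1993, Definition 1.2.4; lane plumbing] -/
theorem snd_iff_mem_signsOf (κ : Word m m) {q : Fin m} (hq : q ∈ freePos m p) : (κ q).2 = true ↔ q ∈ signsOf p κ := by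
  unfold signsOf
  rw [Finset.mem_filter]
  exact ⟨fun h => ⟨hq, h⟩, fun h => h.2⟩

/-- Sign sets on `F` whose membership at `a ∈ F` is tied to the membership at `b ≠ a` (equal iff `c`): `2^{#F − 1}`.
[cite: MadrasSlade1993, Definition 1.2.4; lane plumbing] -/
private theorem card_powerset_filter_mem_iff {F : Finset (Fin m)} {a b : Fin m} (ha : a ∈ F) (hab : a ≠ b) (c : Prop) [Decidable c] :
    (F.powerset.filter fun S => (a ∈ S ↔ (b ∈ S ↔ c))).card = 2 ^ (F.card - 1) := by
  classical
  rw [← Finset.card_erase_of_mem ha, ← Finset.card_powerset]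
  refine Finset.card_nbij' (fun S => S.erase a) (fun T => if (b ∈ T ↔ c) then insert a T else T) (fun S hS => ?_) (fun T hT => ?_) (fun S hS => ?_)
    (fun T hT => ?_)
  · rw [Finset.mem_coe, Finset.mem_filter, Finset.mem_powerset] at hS
    rw [Finset.mem_coe, Finset.mem_powerset]
    exact Finset.erase_subset_erase _ hS.1
  · rw [Finset.mem_coe, Finset.mem_powerset, Finset.subset_erase] at hT
    rw [Finset.mem_coe, Finset.mem_filter, Finset.mem_powerset]
    dsimp only
    have hbT : b ∈ insert a T ↔ b ∈ T := by rw [Finset.mem_insert]; exact ⟨fun h => h.resolve_left hab.symm, Or.inr⟩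
    split_ifs with h
    · exact ⟨Finset.insert_subset ha hT.1, iff_of_true (Finset.mem_insert_self _ _) (hbT.trans h)⟩
    · exact ⟨hT.1, iff_of_false hT.2 h⟩
  · rw [Finset.mem_coe, Finset.mem_filter, Finset.mem_powerset] at hS
    dsimp only
    have hbS : b ∈ S.erase a ↔ b ∈ S := by rw [Finset.mem_erase]; exact ⟨fun h => h.2, fun h => ⟨hab.symm, h⟩⟩
    have hiff : (b ∈ S.erase a ↔ c) ↔ (b ∈ S ↔ c) := by rw [hbS]
    by_cases h : (b ∈ S ↔ c)
    · rw [if_pos (hiff.2 h)]; exact Finset.insert_erase (hS.2.2 h)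
    · rw [if_neg (fun h' => h (hiff.1 h'))]; exact Finset.erase_eq_of_notMem (fun haS => h (hS.2.1 haS))
  · rw [Finset.mem_coe, Finset.mem_powerset, Finset.subset_erase] at hT
    dsimp only
    split_ifs with h
    · exact Finset.erase_insert hT.2
    · exact Finset.erase_eq_of_notMem hT.2

/-! ### ★★ Prescribed letters in a one-block class -/

/-- ★ THE CORE COUNT: the members of `shapeClass j m (topVec m p)` whose letters at the free positions `q' ≠ q` share the axis, with signs equal iff `c`, number
`#{π ∈ goodParts | q' ∈ blockOf π q} · 2^{m−3}`. [cite: MadrasSlade1993, Definition 1.2.4; lane theorem] -/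
theorem card_filter_letter_core {j : ℕ} (hp : p + 4 ≤ m) {q q' : Fin m} (hq : q ∈ freePos m p) (hq' : q' ∈ freePos m p) (hne : q ≠ q') (c : Prop) [Decidable c] :
    ((shapeClass j m (topVec m p)).filter fun κ => (κ q').1 = (κ q).1 ∧ ((κ q').2 = true ↔ ((κ q).2 = true ↔ c))).card =
      ((goodParts m j p hp).filter fun π => q' ∈ blockOf π q).card * 2 ^ (m - 3) := by
  classical
  rw [card_filter_eq_of_leftInv (fun κ => (partOf p κ, signsOf p κ)) (fun d => canon (mkWordP hp d.1 d.2))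
      (fun κ hκ => partOf_signsOf_mem_blockData hκ hp) (fun κ hκ => canon_mkWordP_partOf_signsOf hκ hp) (card_shapeClass_topVec_eq_card_blockData hp)
      _ (fun d => q' ∈ blockOf d.1 q ∧ (q' ∈ d.2 ↔ (q ∈ d.2 ↔ c))) (fun κ _ => by
        dsimp only; rw [fst_eq_iff_mem_blockOf_partOf κ hq hq', snd_iff_mem_signsOf κ hq', snd_iff_mem_signsOf κ hq])]
  unfold blockData
  rw [Finset.filter_product (p := fun π => q' ∈ blockOf π q) (q := fun S => q' ∈ S ↔ (q ∈ S ↔ c)), Finset.card_product,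
    card_powerset_filter_mem_iff hq' hne.symm c, card_freePos hp, show m - 2 - 1 = m - 3 by omega]

/-- ★★ EQUAL LETTERS: `#{κ ∈ shapeClass j m (topVec m p) | κ q' = κ q} = #{π ∈ goodParts | q' ∈ blockOf π q} · 2^{m−3}` for free `q ≠ q'`.
[cite: MadrasSlade1993, Definition 1.2.4; lane theorem] -/
theorem card_filter_letter_eq {j : ℕ} (hp : p + 4 ≤ m) {q q' : Fin m} (hq : q ∈ freePos m p) (hq' : q' ∈ freePos m p) (hne : q ≠ q') :
    ((shapeClass j m (topVec m p)).filter fun κ => κ q' = κ q).card = ((goodParts m j p hp).filter fun π => q' ∈ blockOf π q).card * 2 ^ (m - 3) := by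
  classical
  rw [← card_filter_letter_core hp hq hq' hne True]
  congr 1
  refine Finset.filter_congr fun κ _ => ?_
  rw [Prod.ext_iff, iff_true, Bool.eq_iff_iff]

/-- ★★ REVERSED LETTERS: `#{κ ∈ shapeClass j m (topVec m p) | κ q' = rev (κ q)} = #{π ∈ goodParts | q' ∈ blockOf π q} · 2^{m−3}` for free `q ≠ q'`.
[cite: MadrasSlade1993, Definition 1.2.4; lane theorem] -/
theorem card_filter_letter_rev {j : ℕ} (hp : p + 4 ≤ m) {q q' : Fin m} (hq : q ∈ freePos m p) (hq' : q' ∈ freePos m p) (hne : q ≠ q') :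
    ((shapeClass j m (topVec m p)).filter fun κ => κ q' = ((κ q).1, !(κ q).2)).card =
      ((goodParts m j p hp).filter fun π => q' ∈ blockOf π q).card * 2 ^ (m - 3) := by
  classical
  rw [← card_filter_letter_core hp hq hq' hne False]
  congr 1
  refine Finset.filter_congr fun κ _ => ?_
  rw [Prod.ext_iff, iff_false]
  simp only
  cases (κ q).2 <;> cases (κ q').2 <;> simp

/-! ### ★ The good-partition side in (A, B, ρ) coordinates -/

/-- The rebuilding map undoes the forgetful one. [cite: MadrasSlade1993, Definition 1.2.4; lane plumbing] -/
private theorem ofAB_abOf {j : ℕ} (hp : p + 4 ≤ m) {π : Finset (Finset (Fin m))} (hπ : π ∈ goodParts m j p hp) : ofAB hp (abOf hp π) = π := by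
  classical
  unfold goodParts at hπ
  rw [Finset.mem_filter, mem_setPartitions] at hπ
  obtain ⟨hπ, hsep, -, -⟩ := hπ
  obtain ⟨hp0, hp1⟩ := p_mem_freePos (m := m) hp
  have hP₀π := hπ.blockOf_mem hp0
  have hP₁π := hπ.blockOf_mem hp1
  unfold ofAB abOf
  simp only
  rw [Finset.insert_erase (hπ.mem_blockOf hp0), Finset.insert_erase (hπ.mem_blockOf hp1),
    Finset.insert_erase (Finset.mem_erase.2 ⟨fun h => hsep h.symm, hP₁π⟩), Finset.insert_erase hP₀π]

/-- Filtered good partitions are counted on the (A, B, ρ) side (`j + 2 ≤ m`). [cite: MadrasSlade1993, Definition 1.2.4; lane lemma] -/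
theorem card_goodParts_filter_eq {j : ℕ} (hp : p + 4 ≤ m) (hmj : j + 2 ≤ m) (P : Finset (Finset (Fin m)) → Prop)
    (Q : (Σ _ : Finset (Fin m) × Finset (Fin m), Finset (Finset (Fin m))) → Prop) [DecidablePred P] [DecidablePred Q]
    (hPQ : ∀ π ∈ goodParts m j p hp, P π ↔ Q (abOf hp π)) : ((goodParts m j p hp).filter P).card = ((abData m j p hp).filter Q).card := by
  classical
  exact card_filter_eq_of_leftInv (abOf hp) (ofAB hp) (fun π hπ => abOf_mem_abData hp hπ) (fun π hπ => ofAB_abOf hp hπ) (card_goodParts_eq_card_abData hp hmj) P Q hPQ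

/-- ★ An outer position lies in the block of `p` iff it lies in `A`. [cite: MadrasSlade1993, Definition 1.2.4; lane lemma] -/
theorem card_goodParts_filter_blockOf_base {j : ℕ} (hp : p + 4 ≤ m) (hmj : j + 2 ≤ m) {q' : Fin m} (hq' : q' ∈ outerPos m p hp) :
    ((goodParts m j p hp).filter fun π => q' ∈ blockOf π (⟨p, by omega⟩ : Fin m)).card = ((abData m j p hp).filter fun d => q' ∈ d.1.1).card := by
  classical
  refine card_goodParts_filter_eq hp hmj _ _ fun π _ => ?_
  unfold abOf
  simp only [Finset.mem_erase]
  have : q' ≠ ⟨p, by omega⟩ := fun h => ((mem_outerPos hp).1 hq').2.1 (by rw [h])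
  exact ⟨fun h => ⟨this, h⟩, fun h => h.2⟩

/-- ★ An outer position lies in the block of `p+1` iff it lies in `B`. [cite: MadrasSlade1993, Definition 1.2.4; lane lemma] -/
theorem card_goodParts_filter_blockOf_succ {j : ℕ} (hp : p + 4 ≤ m) (hmj : j + 2 ≤ m) {q' : Fin m} (hq' : q' ∈ outerPos m p hp) :
    ((goodParts m j p hp).filter fun π => q' ∈ blockOf π (⟨p + 1, by omega⟩ : Fin m)).card = ((abData m j p hp).filter fun d => q' ∈ d.1.2).card := by
  classical
  refine card_goodParts_filter_eq hp hmj _ _ fun π _ => ?_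
  unfold abOf
  simp only [Finset.mem_erase]
  have : q' ≠ ⟨p + 1, by omega⟩ := fun h => ((mem_outerPos hp).1 hq').2.2 (by rw [h])
  exact ⟨fun h => ⟨this, h⟩, fun h => h.2⟩

/-- ★ Two outer positions share a block iff both lie in `A`, both lie in `B`, or some block of `ρ` contains both.
[cite: MadrasSlade1993, Definition 1.2.4; lane lemma] -/
theorem card_goodParts_filter_blockOf_outer {j : ℕ} (hp : p + 4 ≤ m) (hmj : j + 2 ≤ m) {q q' : Fin m} (hq : q ∈ outerPos m p hp) (hq' : q' ∈ outerPos m p hp) :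
    ((goodParts m j p hp).filter fun π => q' ∈ blockOf π q).card =
      ((abData m j p hp).filter fun d => (q ∈ d.1.1 ∧ q' ∈ d.1.1) ∨ (q ∈ d.1.2 ∧ q' ∈ d.1.2) ∨ ∃ B ∈ d.2, q ∈ B ∧ q' ∈ B).card := by
  classical
  refine card_goodParts_filter_eq hp hmj _ _ fun π hπ => ?_
  unfold goodParts at hπ
  rw [Finset.mem_filter, mem_setPartitions] at hπ
  obtain ⟨hπ, hsep, -, -⟩ := hπ
  obtain ⟨hqF, hq0, hq1⟩ := (mem_outerPos hp).1 hq
  obtain ⟨hq'F, hq'0, hq'1⟩ := (mem_outerPos hp).1 hq'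
  obtain ⟨hp0, hp1⟩ := p_mem_freePos (m := m) hp
  set P₀ := blockOf π (⟨p, by omega⟩ : Fin m) with hP₀
  set P₁ := blockOf π (⟨p + 1, by omega⟩ : Fin m) with hP₁
  have hBq : blockOf π q ∈ π := hπ.blockOf_mem hqF
  have hqBq : q ∈ blockOf π q := hπ.mem_blockOf hqF
  have hne0 : q ≠ ⟨p, by omega⟩ := fun h => hq0 (by rw [h])
  have hne1 : q ≠ ⟨p + 1, by omega⟩ := fun h => hq1 (by rw [h])
  have hne0' : q' ≠ ⟨p, by omega⟩ := fun h => hq'0 (by rw [h])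
  have hne1' : q' ≠ ⟨p + 1, by omega⟩ := fun h => hq'1 (by rw [h])
  unfold abOf
  simp only [Finset.mem_erase]
  constructor
  · intro h
    by_cases hB0 : blockOf π q = P₀
    · have h1 : q ∈ P₀ := by rw [← hB0]; exact hqBq
      have h2 : q' ∈ P₀ := by rw [← hB0]; exact h
      exact Or.inl ⟨⟨hne0, h1⟩, ⟨hne0', h2⟩⟩
    · by_cases hB1 : blockOf π q = P₁
      · have h1 : q ∈ P₁ := by rw [← hB1]; exact hqBq
        have h2 : q' ∈ P₁ := by rw [← hB1]; exact h
        exact Or.inr (Or.inl ⟨⟨hne1, h1⟩, ⟨hne1', h2⟩⟩)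
      · exact Or.inr (Or.inr ⟨blockOf π q, ⟨hB1, hB0, hBq⟩, hqBq, h⟩)
  · rintro (⟨⟨-, hq0'⟩, ⟨-, hq0''⟩⟩ | ⟨⟨-, hq1'⟩, ⟨-, hq1''⟩⟩ | ⟨B, ⟨-, -, hB⟩, hqB, hq'B⟩)
    · rw [hπ.eq_blockOf (hπ.blockOf_mem hp0) hq0']; exact hq0''
    · rw [hπ.eq_blockOf (hπ.blockOf_mem hp1) hq1']; exact hq1''
    · rw [hπ.eq_blockOf hB hqB]; exact hq'B

/-! ### ★ Marked blocks of `twoParts` -/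

/-- ★ A prescribed PAIR BLOCK: `#{ρ ∈ twoParts W (k+1) | {a, b} ∈ ρ} = #twoParts (W ∖ {a, b}) k` (erase / insert the block).
[cite: Stanley2012EC1, §1.3; lane lemma] -/
theorem card_twoParts_filter_pair_mem {W : Finset (Fin m)} {k : ℕ} {a b : Fin m} (ha : a ∈ W) (hb : b ∈ W) (hab : a ≠ b) :
    ((twoParts W (k + 1)).filter fun ρ => ({a, b} : Finset (Fin m)) ∈ ρ).card = (twoParts (W \ {a, b}) k).card := by
  classical
  refine Finset.card_nbij' (fun ρ => ρ.erase {a, b}) (fun σ => insert {a, b} σ) (fun ρ hρ => ?_) (fun σ hσ => ?_) (fun ρ hρ => ?_) (fun σ hσ => ?_)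
  · rw [Finset.mem_coe, Finset.mem_filter, mem_twoParts] at hρ
    obtain ⟨⟨hρ, h2, hk⟩, hab'⟩ := hρ
    rw [Finset.mem_coe, mem_twoParts]
    exact ⟨hρ.erase hab', fun B hB => h2 B (Finset.mem_of_mem_erase hB), by rw [Finset.card_erase_of_mem hab', hk]; rfl⟩
  · rw [Finset.mem_coe, mem_twoParts] at hσ
    obtain ⟨hσ, h2, hk⟩ := hσ
    have hnot : ({a, b} : Finset (Fin m)) ∉ σ := hσ.notMem_of_sdiff ⟨a, by simp⟩
    rw [Finset.mem_coe, Finset.mem_filter, mem_twoParts]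
    refine ⟨⟨hσ.insert (by intro x hx; simp only [Finset.mem_insert, Finset.mem_singleton] at hx; rcases hx with rfl | rfl <;> assumption) ⟨a, by simp⟩,
      fun B hB => ?_, by rw [Finset.card_insert_of_notMem hnot, hk]⟩, Finset.mem_insert_self _ _⟩
    rcases Finset.mem_insert.1 hB with rfl | hB
    · rw [Finset.card_pair hab]
    · exact h2 B hB
  · rw [Finset.mem_coe, Finset.mem_filter] at hρ
    exact Finset.insert_erase hρ.2
  · rw [Finset.mem_coe, mem_twoParts] at hσ
    exact Finset.erase_insert (hσ.1.notMem_of_sdiff ⟨a, by simp⟩)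

/-- ★ A prescribed pair inside THE TRIPLE (`#W = 2k + 1`): `#{ρ ∈ twoParts W k | ∃ B ∈ ρ, a, b ∈ B, #B = 3} = (2k−1)·(2k−3)‼` — the third element of the triple and a perfect
matching of the other `2k − 2` points. [cite: Stanley2012EC1, §1.3; lane lemma] -/
theorem card_twoParts_filter_triple_mem {W : Finset (Fin m)} {k : ℕ} (hW : W.card = 2 * k + 1) {a b : Fin m} (ha : a ∈ W) (hb : b ∈ W) (hab : a ≠ b) :
    ((twoParts W k).filter fun ρ => ∃ B ∈ ρ, a ∈ B ∧ b ∈ B ∧ B.card = 3).card = (2 * k - 1) * (2 * k - 3).doubleFactorial := by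
  classical
  have hk : 1 ≤ k := by
    have := Finset.card_le_card (show ({a, b} : Finset (Fin m)) ⊆ W by
      intro x hx; simp only [Finset.mem_insert, Finset.mem_singleton] at hx; rcases hx with rfl | rfl <;> assumption)
    rw [Finset.card_pair hab, hW] at this
    omega
  set src := (W \ {a, b}).sigma (fun r => pairPartitions (W \ {a, b, r})) with hsrc
  set g : (Σ _ : Fin m, Finset (Finset (Fin m))) → Finset (Finset (Fin m)) := fun d => insert ({a, b, d.1} : Finset (Fin m)) d.2 with hg
  have hcard_src : src.card = (2 * k - 1) * (2 * k - 3).doubleFactorial := by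
    rw [hsrc, Finset.card_sigma, Finset.sum_const_nat (m := (2 * k - 3).doubleFactorial), Finset.card_sdiff_of_subset (by
      intro x hx; simp only [Finset.mem_insert, Finset.mem_singleton] at hx; rcases hx with rfl | rfl <;> assumption), hW, Finset.card_pair hab]
    · rfl
    · intro r hr
      rw [Finset.mem_sdiff, Finset.mem_insert, Finset.mem_singleton, not_or] at hr
      have h3 : ({a, b, r} : Finset (Fin m)).card = 3 := by
        rw [Finset.card_insert_of_notMem (by simp [hab, Ne.symm hr.2.1]), Finset.card_pair (Ne.symm hr.2.2)]
      rw [card_pairPartitions_of_card_eq_two_mul (n := k - 1) (by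
        rw [Finset.card_sdiff_of_subset (by
          intro x hx; simp only [Finset.mem_insert, Finset.mem_singleton] at hx
          rcases hx with rfl | rfl | rfl
          · exact ha
          · exact hb
          · exact hr.1), hW, h3]; omega)]
      congr 1; omega
  -- facts about a datum of the source
  have hsrc_mem : ∀ d ∈ src, d.1 ∈ W ∧ d.1 ≠ a ∧ d.1 ≠ b ∧ d.2 ∈ pairPartitions (W \ {a, b, d.1}) ∧
      ({a, b, d.1} : Finset (Fin m)).card = 3 ∧ ({a, b, d.1} : Finset (Fin m)) ⊆ W ∧ ({a, b, d.1} : Finset (Fin m)) ∉ d.2 := by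
    intro d hd
    rw [hsrc, Finset.mem_sigma, Finset.mem_sdiff, Finset.mem_insert, Finset.mem_singleton, not_or] at hd
    obtain ⟨⟨hrW, hra, hrb⟩, hσ⟩ := hd
    refine ⟨hrW, hra, hrb, hσ, ?_, ?_, (mem_pairPartitions.1 hσ).1.notMem_of_sdiff ⟨a, by simp⟩⟩
    · rw [Finset.card_insert_of_notMem (by simp [hab, Ne.symm hra]), Finset.card_pair (Ne.symm hrb)]
    · intro x hx; simp only [Finset.mem_insert, Finset.mem_singleton] at hx
      rcases hx with rfl | rfl | rfl <;> assumption
  have hg_mem : ∀ d ∈ src, g d ∈ twoParts W k ∧ blockOf (g d) a = ({a, b, d.1} : Finset (Fin m)) := by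
    intro d hd
    obtain ⟨hrW, hra, hrb, hσ, h3, hTW, hTσ⟩ := hsrc_mem d hd
    obtain ⟨hσp, hσ2⟩ := mem_pairPartitions.1 hσ
    have hins : IsSetPartition W (g d) := hσp.insert hTW ⟨a, by simp⟩
    have hkσ := card_eq_two_mul_of_mem_pairPartitions hσ
    rw [Finset.card_sdiff_of_subset hTW, hW, h3] at hkσ
    refine ⟨mem_twoParts.2 ⟨hins, fun B hB => ?_, ?_⟩, hins.eq_blockOf (Finset.mem_insert_self _ _) (by simp)⟩
    · rcases Finset.mem_insert.1 hB with rfl | hB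
      · rw [h3]; norm_num
      · rw [hσ2 B hB]
    · rw [hg]; simp only; rw [Finset.card_insert_of_notMem hTσ]; omega
  have hinj : Set.InjOn g src := by
    intro d hd d' hd' h
    obtain ⟨-, hra, hrb, -, -, -, hTσ⟩ := hsrc_mem d (Finset.mem_coe.1 hd)
    obtain ⟨-, -, -, -, -, -, hTσ'⟩ := hsrc_mem d' (Finset.mem_coe.1 hd')
    have hT : ({a, b, d.1} : Finset (Fin m)) = {a, b, d'.1} := by
      rw [← (hg_mem d (Finset.mem_coe.1 hd)).2, ← (hg_mem d' (Finset.mem_coe.1 hd')).2, h]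
    have hr : d.1 = d'.1 := by
      have : d.1 ∈ ({a, b, d'.1} : Finset (Fin m)) := by rw [← hT]; simp
      simp only [Finset.mem_insert, Finset.mem_singleton] at this
      rcases this with h1 | h1 | h1
      · exact absurd h1 hra
      · exact absurd h1 hrb
      · exact h1
    have hσ : d.2 = d'.2 := by
      have e1 : d.2 = (g d).erase {a, b, d.1} := by rw [hg]; simp only; rw [Finset.erase_insert hTσ]
      have e2 : d'.2 = (g d').erase {a, b, d'.1} := by rw [hg]; simp only; rw [Finset.erase_insert hTσ']
      rw [e1, e2, h, hT]
    obtain ⟨r, σ⟩ := d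
    obtain ⟨r', σ'⟩ := d'
    simp only at hr hσ
    subst hr hσ
    rfl
  have himage : src.image g = (twoParts W k).filter fun ρ => ∃ B ∈ ρ, a ∈ B ∧ b ∈ B ∧ B.card = 3 := by
    ext ρ
    rw [Finset.mem_image, Finset.mem_filter]
    constructor
    · rintro ⟨d, hd, rfl⟩
      obtain ⟨-, -, -, -, h3, -, -⟩ := hsrc_mem d hd
      exact ⟨(hg_mem d hd).1, {a, b, d.1}, Finset.mem_insert_self _ _, by simp, by simp, h3⟩
    · rintro ⟨hρ, B, hB, haB, hbB, hB3⟩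
      have hρp := (mem_twoParts.1 hρ).1
      obtain ⟨T, hT, hT3, huniq⟩ := exists_unique_triple_of_mem_twoParts hW hρ
      have hBT : B = T := by by_contra hne; have := huniq B hB hne; omega
      -- the third element
      have hR : ((B.erase a).erase b).card = 1 := by
        rw [Finset.card_erase_of_mem (Finset.mem_erase.2 ⟨hab.symm, hbB⟩), Finset.card_erase_of_mem haB, hB3]
      obtain ⟨r, hr⟩ := Finset.card_eq_one.1 hR
      have hrB : r ∈ (B.erase a).erase b := by rw [hr]; exact Finset.mem_singleton_self _
      rw [Finset.mem_erase, Finset.mem_erase] at hrB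
      obtain ⟨hrb, hra, hrB⟩ := hrB
      have hBeq : B = {a, b, r} := by
        rw [← Finset.insert_erase haB, ← Finset.insert_erase (Finset.mem_erase.2 ⟨hab.symm, hbB⟩), hr]
      refine ⟨⟨r, ρ.erase B⟩, ?_, ?_⟩
      · rw [hsrc, Finset.mem_sigma, Finset.mem_sdiff, Finset.mem_insert, Finset.mem_singleton, not_or, mem_pairPartitions, ← hBeq]
        refine ⟨⟨hρp.subset hB hrB, hra, hrb⟩, hρp.erase hB, fun B' hB' => ?_⟩
        exact huniq B' (Finset.mem_of_mem_erase hB') (hBT ▸ Finset.ne_of_mem_erase hB')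
      · rw [hg]; simp only; rw [← hBeq, Finset.insert_erase hB]
  rw [← himage, Finset.card_image_of_injOn hinj, hcard_src]

/-- On `2k + 1` points two distinct elements share a block of `ρ ∈ twoParts W k` iff `{a, b}` is a block or both lie in the triple (exclusive cases).
[cite: Stanley2012EC1, §1.3; lane lemma] -/
theorem sameBlock_iff_of_card_eq_succ {W : Finset (Fin m)} {k : ℕ} (hW : W.card = 2 * k + 1) {ρ : Finset (Finset (Fin m))} (hρ : ρ ∈ twoParts W k)
    {a b : Fin m} (hab : a ≠ b) :
    (∃ B ∈ ρ, a ∈ B ∧ b ∈ B) ↔ (({a, b} : Finset (Fin m)) ∈ ρ ∨ ∃ B ∈ ρ, a ∈ B ∧ b ∈ B ∧ B.card = 3) := by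
  classical
  constructor
  · rintro ⟨B, hB, haB, hbB⟩
    obtain ⟨T, hT, hT3, huniq⟩ := exists_unique_triple_of_mem_twoParts hW hρ
    by_cases hBT : B = T
    · exact Or.inr ⟨B, hB, haB, hbB, hBT ▸ hT3⟩
    · have h2 := huniq B hB hBT
      have : ({a, b} : Finset (Fin m)) = B :=
        Finset.eq_of_subset_of_card_le (by intro x hx; simp only [Finset.mem_insert, Finset.mem_singleton] at hx; rcases hx with rfl | rfl <;> assumption)
          (by rw [h2, Finset.card_pair hab])
      exact Or.inl (this ▸ hB)
  · rintro (h | ⟨B, hB, haB, hbB, -⟩)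
    · exact ⟨{a, b}, h, by simp, by simp⟩
    · exact ⟨B, hB, haB, hbB⟩

/-- On `2k` points (perfect matchings) two distinct elements share a block iff `{a, b}` is a block. [cite: GlimmJaffeQP1987, (3.2.13) §3.2; lane lemma] -/
theorem sameBlock_iff_of_card_eq {W : Finset (Fin m)} {k : ℕ} (hW : W.card = 2 * k) {ρ : Finset (Finset (Fin m))} (hρ : ρ ∈ twoParts W k)
    {a b : Fin m} (hab : a ≠ b) : (∃ B ∈ ρ, a ∈ B ∧ b ∈ B) ↔ ({a, b} : Finset (Fin m)) ∈ ρ := by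
  classical
  rw [twoParts_eq_pairPartitions hW, mem_pairPartitions] at hρ
  constructor
  · rintro ⟨B, hB, haB, hbB⟩
    have : ({a, b} : Finset (Fin m)) = B :=
      Finset.eq_of_subset_of_card_le (by intro x hx; simp only [Finset.mem_insert, Finset.mem_singleton] at hx; rcases hx with rfl | rfl <;> assumption)
        (by rw [hρ.2 B hB, Finset.card_pair hab])
    exact this ▸ hB
  · intro h; exact ⟨{a, b}, h, by simp, by simp⟩

/-! ### ★★ The five-run decomposition for every `m` -/

section Five

variable {j s : ℕ}

/-- ★★ THE FIVE-RUN CLASS IS THE UNION OF THE TWO ONE-BLOCK CLASSES INSIDE IT, EACH CUT BY ITS ONE EXTRA NO-REVERSAL CONDITION (every `m`, `s + 5 ≤ m`): offset `0` with no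
reversal at `(s+3, s+4)`, offset `1` with no reversal at `(s, s+1)`. [cite: MadrasSlade1993, Definition 1.2.4; lane theorem] -/
theorem shapeClass_fiveVec_eq_union_filter (hs : s + 5 ≤ m) :
    shapeClass j m (fiveVec m s) =
      (shapeClass j m (topVec m s)).filter (fun κ => ¬ κ ⟨s + 4, by omega⟩ = ((κ ⟨s + 3, by omega⟩).1, !(κ ⟨s + 3, by omega⟩).2)) ∪
      (shapeClass j m (topVec m (s + 1))).filter (fun κ => ¬ κ ⟨s + 1, by omega⟩ = ((κ ⟨s, by omega⟩).1, !(κ ⟨s, by omega⟩).2)) := by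
  classical
  ext κ
  rw [Finset.mem_union, Finset.mem_filter, Finset.mem_filter]
  constructor
  · intro hκ
    have hnr : RunNoRev (fiveVec m s) κ := ((mem_shapeClass_iff.1 hκ).2.2.2.1)
    have e34 : (⟨(⟨s + 3, by omega⟩ : Fin m).val + 1, by simp only; omega⟩ : Fin m) = ⟨s + 4, by omega⟩ := Fin.ext (by simp)
    have e01 : (⟨(⟨s, by omega⟩ : Fin m).val + 1, by simp only; omega⟩ : Fin m) = ⟨s + 1, by omega⟩ := Fin.ext (by simp)
    have h34 := hnr ⟨s + 3, by omega⟩ (by simp only; omega) ((fiveVec_eq_true_iff _).2 ⟨by simp only; omega, by simp only; omega⟩)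
    have h01 := hnr ⟨s, by omega⟩ (by simp only; omega) ((fiveVec_eq_true_iff _).2 ⟨le_rfl, by simp only; omega⟩)
    rw [e34] at h34
    rw [e01] at h01
    rcases mem_topVec_of_mem_fiveVec hs hκ with h | h
    · exact Or.inl ⟨h, h34⟩
    · exact Or.inr ⟨h, h01⟩
  · have hs4 : s + 4 < m := by omega
    have hs3 : s + 3 < m := by omega
    have hs1 : s + 1 < m := by omega
    have hs0 : s < m := by omega
    rintro (⟨hκ, hq⟩ | ⟨hκ, hq⟩)
    · rw [mem_shapeClass_iff] at hκ ⊢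
      obtain ⟨hcan, hax, hrep, hnr, a, a', haa', ha', hA, hpos⟩ := hκ
      refine ⟨hcan, hax, hrep, fun k hk hAk => ?_, ⟨a, a', haa', ha', fun k hk hk' => ?_, hpos⟩⟩
      · rw [fiveVec_eq_true_iff] at hAk
        by_cases hk3 : k.val = s + 3
        · have e1 : (⟨k.val + 1, hk⟩ : Fin m) = ⟨s + 4, hs4⟩ := Fin.ext (by simp only; omega)
          have e0 : κ k = κ ⟨s + 3, hs3⟩ := congrArg κ (Fin.ext hk3)
          rw [e1, e0]; exact hq
        · exact hnr k hk ((topVec_eq_true_iff k).2 ⟨hAk.1, by omega⟩)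
      · have := hA k hk hk'
        rw [topVec_eq_true_iff] at this
        exact (fiveVec_eq_true_iff k).2 ⟨this.1, by omega⟩
    · rw [mem_shapeClass_iff] at hκ ⊢
      obtain ⟨hcan, hax, hrep, hnr, a, a', haa', ha', hA, hpos⟩ := hκ
      refine ⟨hcan, hax, hrep, fun k hk hAk => ?_, ⟨a, a', haa', ha', fun k hk hk' => ?_, hpos⟩⟩
      · rw [fiveVec_eq_true_iff] at hAk
        by_cases hk0 : k.val = s
        · have e1 : (⟨k.val + 1, hk⟩ : Fin m) = ⟨s + 1, hs1⟩ := Fin.ext (by simp only; omega)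
          have e0 : κ k = κ ⟨s, hs0⟩ := congrArg κ (Fin.ext hk0)
          rw [e1, e0]; exact hq
        · exact hnr k hk ((topVec_eq_true_iff k).2 ⟨by omega, by omega⟩)
      · have := hA k hk hk'
        rw [topVec_eq_true_iff] at this
        exact (fiveVec_eq_true_iff k).2 ⟨by omega, by omega⟩

/-- ★ THE OVERLAP: a member of both one-block classes at offsets `0` and `1` reads `x y x̄ ȳ x` on `[s, s+5)`; conversely `κ (s+4) = κ s` in the offset-`0` class puts `κ` in the
offset-`1` class (every `m`). [cite: MadrasSlade1993, Definition 1.2.4; lane lemma] -/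
theorem inter_topVec_succ_eq_filter (hs : s + 5 ≤ m) :
    shapeClass j m (topVec m s) ∩ shapeClass j m (topVec m (s + 1)) = (shapeClass j m (topVec m s)).filter fun κ => κ ⟨s + 4, by omega⟩ = κ ⟨s, by omega⟩ := by
  classical
  ext κ
  rw [Finset.mem_inter, Finset.mem_filter]
  constructor
  · rintro ⟨h0, h1⟩
    refine ⟨h0, ?_⟩
    obtain ⟨a2, -, -⟩ := top_block_general h0 (by omega)
    obtain ⟨-, b3, -⟩ := top_block_general h1 hs
    have e1 : (⟨s + 1 + 3, by omega⟩ : Fin m) = ⟨s + 4, by omega⟩ := Fin.ext (show s + 1 + 3 = s + 4 by omega)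
    have e2 : (⟨s + 1 + 1, by omega⟩ : Fin m) = ⟨s + 2, by omega⟩ := Fin.ext rfl
    rw [e1, e2, a2] at b3
    simpa using b3
  · have hs4 : s + 4 < m := by omega
    have hs3 : s + 3 < m := by omega
    rintro ⟨h0, h40⟩
    refine ⟨h0, ?_⟩
    obtain ⟨a2, a3, hne⟩ := top_block_general h0 (by omega)
    have h0' := h0
    rw [mem_shapeClass_iff] at h0' ⊢
    obtain ⟨hcan, hax, hrep, hnr, -⟩ := h0'
    refine ⟨hcan, hax, hrep, fun k hk hAk => ?_, ⟨s + 1, s + 5, by omega, hs, fun k hk hk' => (topVec_eq_true_iff k).2 ⟨hk, by omega⟩, ?_⟩⟩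
    · rw [topVec_eq_true_iff] at hAk
      by_cases hk3 : k.val = s + 3
      · have e1 : (⟨k.val + 1, hk⟩ : Fin m) = ⟨s + 4, hs4⟩ := Fin.ext (by simp only; omega)
        have e0 : κ k = κ ⟨s + 3, hs3⟩ := congrArg κ (Fin.ext hk3)
        rw [e1, e0, h40, a3]
        intro h
        have := congrArg Prod.fst h
        simp only at this
        exact hne this
      · exact hnr k hk ((topVec_eq_true_iff k).2 ⟨by omega, by omega⟩)
    · rw [wordPos_eq_iff_bsumW κ (by omega) hs]
      have hz := (bsumW_top_eq_zero h0).2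
      rw [bsumW_succ κ (by omega) (by omega), bsumW_succ κ (by omega) (by omega), bsumW_succ κ (by omega) (by omega),
        bsumW_succ κ (by omega) (by omega), bsumW_self] at hz ⊢
      rw [h40]
      convert hz using 1
      abel

/-- Reversal is symmetric: `y = rev x ↔ x = rev y`. [cite: MadrasSlade1993, Definition 1.2.4; lane plumbing] -/
private theorem eq_rev_comm (x y : Fin m × Bool) : y = (x.1, !x.2) ↔ x = (y.1, !y.2) := by
  obtain ⟨a, u⟩ := x; obtain ⟨b, v⟩ := y
  simp only [Prod.mk.injEq]
  cases u <;> cases v <;> simp [eq_comm]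

/-- ★★ THE FIVE-RUN COUNT IDENTITY (every `m`, `s + 5 ≤ m`): `#five(s) + #{κ ∈ T_s | κ(s+4) = κ(s+1)} + #{κ ∈ T_{s+1} | κ s = rev κ(s+1)} + #{κ ∈ T_s | κ(s+4) = κ s} =
#T_s + #T_{s+1}` (`T_t = shapeClass j m (topVec m t)`): inclusion–exclusion on `shapeClass_fiveVec_eq_union_filter`, the reversal at `(s+3, s+4)` being `κ(s+4) = κ(s+1)`
(the block reads `x y x̄ ȳ`) and the overlap being `inter_topVec_succ_eq_filter`. [cite: MadrasSlade1993, Definition 1.2.4; lane theorem] -/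
theorem card_shapeClass_fiveVec_add (hs : s + 5 ≤ m) :
    (shapeClass j m (fiveVec m s)).card +
      ((shapeClass j m (topVec m s)).filter fun κ => κ ⟨s + 4, by omega⟩ = κ ⟨s + 1, by omega⟩).card +
      ((shapeClass j m (topVec m (s + 1))).filter fun κ => κ ⟨s, by omega⟩ = ((κ ⟨s + 1, by omega⟩).1, !(κ ⟨s + 1, by omega⟩).2)).card +
      ((shapeClass j m (topVec m s)).filter fun κ => κ ⟨s + 4, by omega⟩ = κ ⟨s, by omega⟩).card =
      (shapeClass j m (topVec m s)).card + (shapeClass j m (topVec m (s + 1))).card := by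
  classical
  set T0 := shapeClass j m (topVec m s) with hT0
  set T1 := shapeClass j m (topVec m (s + 1)) with hT1
  set L := T0.filter (fun κ => ¬ κ ⟨s + 4, by omega⟩ = ((κ ⟨s + 3, by omega⟩).1, !(κ ⟨s + 3, by omega⟩).2)) with hL
  set R := T1.filter (fun κ => ¬ κ ⟨s + 1, by omega⟩ = ((κ ⟨s, by omega⟩).1, !(κ ⟨s, by omega⟩).2)) with hR
  have hunion : shapeClass j m (fiveVec m s) = L ∪ R := shapeClass_fiveVec_eq_union_filter hs
  have hie := Finset.card_union_add_card_inter L R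
  -- the complements of the two cuts
  have hLc : L.card + (T0.filter fun κ => κ ⟨s + 4, by omega⟩ = κ ⟨s + 1, by omega⟩).card = T0.card := by
    have h := Finset.card_filter_add_card_filter_not (s := T0) (fun κ => ¬ κ ⟨s + 4, by omega⟩ = ((κ ⟨s + 3, by omega⟩).1, !(κ ⟨s + 3, by omega⟩).2))
    rw [← hL] at h
    rw [← h]
    congr 2
    refine Finset.filter_congr fun κ hκ => ?_
    rw [not_not]
    obtain ⟨-, a3, -⟩ := top_block_general hκ (by omega)
    rw [a3]; simp
  have hRc : R.card + (T1.filter fun κ => κ ⟨s, by omega⟩ = ((κ ⟨s + 1, by omega⟩).1, !(κ ⟨s + 1, by omega⟩).2)).card = T1.card := by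
    have h := Finset.card_filter_add_card_filter_not (s := T1) (fun κ => ¬ κ ⟨s + 1, by omega⟩ = ((κ ⟨s, by omega⟩).1, !(κ ⟨s, by omega⟩).2))
    rw [← hR] at h
    rw [← h]
    congr 2
    refine Finset.filter_congr fun κ _ => ?_
    rw [not_not]
    exact eq_rev_comm _ _
  -- the intersection of the cut classes is the intersection of the classes
  have hinter : L ∩ R = T0.filter fun κ => κ ⟨s + 4, by omega⟩ = κ ⟨s, by omega⟩ := by
    rw [← inter_topVec_succ_eq_filter hs, ← hT0, ← hT1]
    ext κ
    rw [Finset.mem_inter, Finset.mem_inter, hL, hR, Finset.mem_filter, Finset.mem_filter]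
    constructor
    · rintro ⟨⟨h0, -⟩, ⟨h1, -⟩⟩; exact ⟨h0, h1⟩
    · rintro ⟨h0, h1⟩
      have h40 : κ ⟨s + 4, by omega⟩ = κ ⟨s, by omega⟩ := by
        have := (inter_topVec_succ_eq_filter (j := j) hs).le (Finset.mem_inter.2 ⟨h0, h1⟩)
        exact (Finset.mem_filter.1 this).2
      obtain ⟨a2, a3, hne⟩ := top_block_general h0 (by omega)
      refine ⟨⟨h0, fun h => hne ?_⟩, ⟨h1, fun h => hne ?_⟩⟩
      · rw [h40, a3] at h
        have := congrArg Prod.fst h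
        simpa using this
      · have := congrArg Prod.fst h
        simpa using this.symm
  rw [hunion, ← hinter]
  omega

end Five

end WordTypes

end Literature.Probability.RandomPlanarGeometry.SAW.Zd
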